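import Summits.QuantumFields.YangMills.Theorems.BalabanLadderIRColdDoublingRecursionSC
import HarnessLib

/-!
# Line `aspect-bootstrap` on crux `BalabanLadder.IR` (stmt-QuantumFields-19354, rung R2c) — rev 3: ALL STUBS LANDED, 0 sorries

Cell ym-ir, seat ym-ir-idea-6 g2 (lens: finite-size-scaling typed conjectures), LINE 3; lead prover ym-ir-line-ab-p1 g0
(2026-08-28).  Slot `Cruxes/IR/Lines/aspect_bootstrap.lean`; the skeleton of record stays
`Cruxes/IR/Lines/af_pincer_Uc_sharp.lean`.

HONEST FRAMING.  The Yang–Mills mass gap (Clay) is NOT proved by anything here.  R4 (`BalabanUVStability4`) closes only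
the conditional finite-𝕋⁴ rung `BalabanLadder.UV`.  This line DISCHARGES one stub of the alternative lines
`floor-handshake` / `doubling-bridge` — the contraction `R = ColdDoublingRecursionSC` (census B15 «missing bootstrap») — and
nothing else: the exit `H`/`E` (+ pin `X`) and the residual `N` of those lines are untouched and remain their whole weight.
`R` carries no Yang–Mills difficulty (it holds for every compact gauge group at every `β ≥ 0`).

REV 3 (lead prover): everything of revs 1–2 is now IN THE TREE, sorry-free, and this line file only re-exports it:
* §1 abstract bootstrap — `Theorems/BalabanLadderIRDefectSquaringOneBox.lean` (p594973: `HasSpectralDatum`, `phi`, `exc`,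
  `Yfun`, `exc_two_mul_le_sq`, `pow_le_pow_of_le`, `defect_facts`, …) and `Theorems/BalabanLadderIRDefectSquaring.lean`
  (p595216: `IsAxisSymmetric`, `IsTracePositive`, `HasVolumeBounds`, `boxDefect`, `squaringConst`, `slope_bound`,
  `extension_step`, `extension_le`, **`defectSquaring`**);
* §2 model facts — [Sym] `axisSymmetric`, [Vol] `volumeBounds` (`Theorems/BalabanLadderIRDefectSquaringWilson.lean`, p595999,
  from Literature `WilsonFinTorusPartitionSymmetry.lean`, seat ym-ir-lit-4, p594707) and [TM-aniso] **`tracePositive`**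
  (`Theorems/BalabanLadderIRColdDoublingRecursionSC.lean`, from the NEW Literature transfer-matrix formalism for ANISOTROPIC
  spatial boxes: `WilsonFinTorusSliceKernel.lean` p595744, `WilsonFinTorusSliceChain.lean` p596067,
  `WilsonFinTorusSpectralData.lean` — `exists_spectralData_wilsonFinTorusPartition_box`: `Z(b₁,b₂,b₃,m+2) = Σᵢ λᵢ^{m+2}`,
  `0 ≤ λᵢ ≤ λ_{i₀}`, `0 < λ_{i₀}`, Lüscher positivity + Hilbert–Schmidt eigenbasis + Jentzsch, time = the last axis);
* §3 **`coldDoublingRecursionSC_holds : ColdPurityBridge.ColdDoublingRecursionSC`** — `R` CLOSED BY NAME in the tree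
  (`C = squaringConst = 2·432²·e^{432}`, `β₀ = 0`, `L₀ = 8`).
Below: the line's own currency (§0, VERBATIM `floor-handshake` / `doubling-bridge`, kept for `Iff.rfl` with those files) and
`R_of_stubs` discharged by the landed theorem (no `sorry` anywhere).

THE MECHANISM («aspect-ratio bootstrap»; card MECHANISM-ym-ir-idea-6.md; details in the module docstring of
`Theorems/BalabanLadderIRDefectSquaring.lean`): side extension read in the transposed channel (ℓᵖ-monotonicity of the
spectrum) + «Casimir slope ≤ slab pressure» + closure of the dyadic tower because the cold defect lives at aspect
`4 : 1 > 2 : 1` (`extension_le`) + three side extensions by [Sym] + time-doubling squaring (`exc_two_mul_le_sq`):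
`δ(L') ≤ 2 (e^{432 δ(L)} − 1)² ≤ squaringConst · δ(L)²` for `L ≥ 8`, `L' ∈ [2L, 4L]`.
-/

noncomputable section

open MeasureTheory
open Literature.MathematicalPhysics.QuantumFieldTheory Literature.MathematicalPhysics.QuantumLattice

namespace Summit.QuantumFields.YangMills.Cruxes.IR.AspectBootstrapLine

/-! ## §0 The currency (VERBATIM lines `doubling-bridge` / `floor-handshake`) -/

section Defs

variable {G : Type} [Group G] [TopologicalSpace G] [IsTopologicalGroup G] [CompactSpace G]
  [MeasurableSpace G] [BorelSpace G]

/-- The **cold period-doubling defect** `δᶜ_β(L) = 1 − Z_β(L,L,L,2⌊L/4⌋) / Z_β(L,L,L,⌊L/4⌋)²` (VERBATIM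
`FloorHandshake.coldDefect` / `DoublingBridge.coldDefect` / `ColdPurityBridge.coldDefect`). -/
def coldDefect {N : ℕ} (ρ : G →* Matrix (Fin N) (Fin N) ℂ) (β : ℝ) (L : ℕ) : ℝ :=
  1 - wilsonFinTorusPartition ρ β L L L (2 * (L / 4)) / wilsonFinTorusPartition ρ β L L L (L / 4) ^ 2

end Defs

/-- **R — `ColdDoublingRecursionSC`** (VERBATIM the rank-3 stub of line `floor-handshake` = rank-2 stub `R` of line
`doubling-bridge` = `ColdPurityBridge.ColdDoublingRecursionSC`; one item by normalised signature): the cold defect contracts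
quadratically under spatial extension `L ↦ L' ∈ [2L, 4L]` past thresholds, ONE constant `C` uniform in `β`. -/
def ColdDoublingRecursionSC : Prop :=
  ∀ (G : Type) [Group G] [TopologicalSpace G] [IsTopologicalGroup G] [CompactSpace G],
    IsCompactSimpleLieGroup G → SimplyConnectedSpace G →
    letI : MeasurableSpace G := borel G
    haveI : BorelSpace G := ⟨rfl⟩
    ∀ r : LatticeRep G, ∃ C β₀ : ℝ, ∃ L₀ : ℕ, 0 < C ∧ ∀ β : ℝ, β₀ ≤ β → ∀ L : ℕ, L₀ ≤ L →
      ∀ L' : ℕ, 2 * L ≤ L' → L' ≤ 4 * L → coldDefect r.ρ β L' ≤ C * coldDefect r.ρ β L ^ 2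

/-- The line's `R` IS the tree's `ColdPurityBridge.ColdDoublingRecursionSC` (definitional). -/
theorem coldDoublingRecursionSC_iff :
    ColdDoublingRecursionSC ↔ Summit.QuantumFields.YangMills.Cruxes.IR.ColdPurityBridge.ColdDoublingRecursionSC :=
  Iff.rfl

/-! ## §3 The composition: `R` from the LANDED theorem (no stub left) -/

/-- **`R` holds** — discharged by the tree theorem `AspectBootstrap.coldDoublingRecursionSC_holds`
(`Theorems/BalabanLadderIRColdDoublingRecursionSC.lean`): [Sym] + [TM-aniso] + [Vol] + `defectSquaring`. -/
theorem R_of_stubs : ColdDoublingRecursionSC :=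
  Summit.QuantumFields.YangMills.Cruxes.IR.AspectBootstrap.coldDoublingRecursionSC_holds

end Summit.QuantumFields.YangMills.Cruxes.IR.AspectBootstrapLine

end
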